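import Literature.Geometry.Riemannian.QCurvatureFour
import Literature.Geometry.Riemannian.GurskyViaclovskyPath
import Literature.Geometry.Riemannian.BakryEmeryHeatFlow
import HarnessLib

/-!
# Chang–Gursky–Yang 2003: the pointwise curvature quantities `|Rm|²`, `|E|²`, `|W|²`, `σ₂(A)`, `Q`
# are `C^∞` functions of a `C^∞` metric

Companion of `ChangGurskyYangRegularity.lean` (which proves CONTINUITY of `|Rm|²_g`, `|E_g|²`,
`|W_g|²`, `σ₂(A_g)` by identifying the tree's frame suprema with intrinsic quantities read in
charts) and of `QCurvatureFour.lean` (`Q = (1/12)(−ΔR + ¼R² − 3|E|²)`, continuity): here the same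
identifications give SMOOTHNESS. These functions are the coefficients of the equations of §1 of
Chang–Gursky–Yang 2003 — the Euler equation (1.13)/(1.16) of the functional `F` and the family
`(⋆)_δ`: `σ₂(A) − (α/4)|W|² = (δ/4)ΔR − 2γ̃₁|η|²` (p. 116), whose continuity method ("we compute
the linearization of `(⋆)_δ` … implicit function theorem") and elliptic regularity presuppose
smooth coefficients (p. 111: "`σ_k(g⁻¹A)` is a smooth function on `M⁴`") — and the right-hand
side `P_t(g) = σ₂(A_g) − ¼|W_g|² + (1−t)(2−t)R_g²/6` at the start of the Gursky–Viaclovsky path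
(`GurskyViaclovskyPath.pathOperator`). Everything is PROVED; no definition, no named fact:

* `contMDiff_curvNormSqWith` — `|Rm|²_g` (`curvNormSqWith`, Topping 2006, (3.2.4)) is `C^∞`: on
  each chart domain it is the smooth coordinate function `rmNormSqAt` of the metric components
  (`IsMetricOn.contDiffOn_rmNormSqAt`, `curvNormSqWith_chartInv_eq'`) composed with the chart;
* `contMDiff_tracelessRicciNormSq` (`|E|² = |Ric|² − S²/4`), `contMDiff_weylNormSq`
  (`|W|² = |Rm|² − 2|Ric|² + S²/3`, Besse 1987, (1.116)–1.117), `contMDiff_sigma2WeylSchouten`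
  (`σ₂(A) = −½|E|² + R²/24`) — for a Riemannian `C^∞` metric on a `4`-dimensional boundaryless
  model, from `contMDiff_normSq_ricci'`, `contMDiff_scalarCurvature` and the previous item;
* `contMDiff_qCurvature` — `Q = (1/12)(−Δ_g R + ¼R² − 3|E|²)` is `C^∞` (`contMDiff_dalembertian`
  of `BakryEmeryHeatFlow.lean` for the Laplacian of the smooth function `R`);
* `contMDiff_pathOperator` — the Weyl-weighted Gursky–Viaclovsky path operator
  `σ₂(A_h) − ¼|W_h|² + (1−t)(2−t)R_h²/6` is `C^∞` for every real `t`;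
* `exists_pathOperator_pos` — **the path starts** (Gursky–Viaclovsky 2003, §3: "Since `R_g > 0`,
  there exists `δ > −∞` so that `A^δ_g` is positive definite"): on a compact `4`-manifold with
  `R_h > 0` there is `δ ≤ 1` with `P_δ(h) > 0` everywhere (compactness: `P_1 ≥ C`, `R ≥ m > 0`).

## References

* S.-Y. A. Chang, M. J. Gursky, P. C. Yang, *A conformally invariant sphere theorem in four
  dimensions*, Publ. Math. IHÉS 98 (2003) 105–143: (0.2) p. 106, §1 p. 111 ("`σ_k(g⁻¹A)` is a
  smooth function"), (1.11) p. 113, (1.16) and `(⋆)_δ` p. 116. [ChangGurskyYang2003]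
* A. L. Besse, *Einstein Manifolds*, Springer 1987, (1.116)–1.117. [Besse1987]
* P. Topping, *Lectures on the Ricci flow*, LMS LNS 325 (2006), §3.2, (3.2.4). [Topping2006]
* M. J. Gursky, J. A. Viaclovsky, *A fully nonlinear equation on four-manifolds with positive
  scalar curvature*, J. Differential Geom. 63 (2003) 131–154, §3 (the path). [GurskyViaclovsky2003]
-/

noncomputable section

open Bundle Set Function Filter Manifold Module
open scoped Manifold ContDiff Topology

namespace Literature.Geometry.Riemannian

open Literature.Geometry.Lorentzian (PseudoRiemannianMetric)
open Literature.Geometry.Lorentzian.PseudoRiemannianMetric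
open Literature.Geometry.Lorentzian

section Smoothness

variable {E : Type*} [NormedAddCommGroup E] [NormedSpace ℝ E] {H : Type*} [TopologicalSpace H]
  {I : ModelWithCorners ℝ E H} {M : Type*} [TopologicalSpace M] [ChartedSpace H M]
  [IsManifold I ∞ M]
  (g : PseudoRiemannianMetric I ∞ E (TangentSpace I : M → Type _))
  [FiniteDimensional ℝ E] [g.HasLeviCivita] [CompleteSpace E] [I.Boundaryless]

/-- **`|Rm|²_g` is a `C^∞` function** for a `C^∞` metric with its Levi-Civita connection: on each
chart domain it is the smooth coordinate function `rmNormSqAt` of the metric components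
(`IsMetricOn.contDiffOn_rmNormSqAt`, `Lorentzian/CoordCurvatureNormSq.lean`) composed with the
chart (`curvNormSqWith_chartInv_eq'`) — the smooth upgrade of `continuous_curvNormSqWith`.
[cite: Topping2006, §3.2, (3.2.4)] -/
theorem _root_.Literature.Geometry.Lorentzian.PseudoRiemannianMetric.contMDiff_curvNormSqWith :
    ContMDiff I 𝓘(ℝ) ∞ fun x ↦ g.curvNormSqWith g.leviCivita x := by
  have hLC : g.IsLeviCivita g.leviCivita := g.isLeviCivita_leviCivita_holds
  intro x₀
  have hy₀ : extChartAt I x₀ x₀ ∈ (extChartAt I x₀).target := mem_extChartAt_target x₀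
  have hsrc : ∀ᶠ p in 𝓝 x₀, p ∈ (extChartAt I x₀).source :=
    (isOpen_extChartAt_source x₀).mem_nhds (mem_extChartAt_source x₀)
  have hF : ContMDiffAt 𝓘(ℝ, E) 𝓘(ℝ) ∞
      (MetricCoord.rmNormSqAt (chartRep I (fun _ ↦ g) x₀ 0)) (extChartAt I x₀ x₀) :=
    ((isMetricOn_chartRep_const g x₀).contDiffOn_rmNormSqAt.contDiffAt
      ((isOpen_extChartAt_target x₀).mem_nhds hy₀)).contMDiffAt
  have hc : ContMDiffAt I 𝓘(ℝ) ∞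
      (MetricCoord.rmNormSqAt (chartRep I (fun _ ↦ g) x₀ 0) ∘ extChartAt I x₀) x₀ :=
    hF.comp x₀ contMDiffAt_extChartAt
  refine hc.congr_of_eventuallyEq ?_
  filter_upwards [hsrc] with p hp
  have hpy : extChartAt I x₀ p ∈ (extChartAt I x₀).target := (extChartAt I x₀).map_source hp
  have h := curvNormSqWith_chartInv_eq' hLC x₀ ⟨extChartAt I x₀ p, hpy⟩
  have hinv : chartInv I x₀ ⟨extChartAt I x₀ p, hpy⟩ = p := (extChartAt I x₀).left_inv hp
  rw [hinv] at h
  exact h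

omit [I.Boundaryless] in
/-- **`|E_g|²` is `C^∞`** (`|Ric|²_g − S²/4`, `tracelessRicciNormSq_eq_normSq`, with both terms `C^∞`:
`contMDiff_normSq_ricci'`, `contMDiff_scalarCurvature`), for a Riemannian `C^∞` metric on a
`4`-dimensional model. [cite: ChangGurskyYang2003, (0.2)] -/
theorem _root_.Literature.Geometry.Lorentzian.PseudoRiemannianMetric.contMDiff_tracelessRicciNormSq
    (hg : g.IsRiemannian) (hE : finrank ℝ E = 4) : ContMDiff I 𝓘(ℝ) ∞ g.tracelessRicciNormSq := by
  have h : g.tracelessRicciNormSq = fun x ↦ g.normSq x (g.ricci x) - g.scalarCurvature x ^ 2 / 4 :=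
    funext fun x ↦ g.tracelessRicciNormSq_eq_normSq hg hE x
  rw [h]
  exact g.contMDiff_normSq_ricci'.sub ((g.contMDiff_scalarCurvature.pow 2).div_const _)

/-- **`|W_g|²` is `C^∞`** (`|Rm|² − 2|Ric|² + S²/3`, `weylNormSq_eq_curvNormSqWith`, each term `C^∞`),
for a Riemannian `C^∞` metric on a boundaryless `4`-dimensional model (Chang–Gursky–Yang 2003,
p. 116: the coefficient of the Weyl term of `(⋆)_δ`). [cite: Besse1987, (1.116)–1.117]
[cite: ChangGurskyYang2003, §1, p. 116] -/
theorem _root_.Literature.Geometry.Lorentzian.PseudoRiemannianMetric.contMDiff_weylNormSq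
    (hg : g.IsRiemannian) (hE : finrank ℝ E = 4) : ContMDiff I 𝓘(ℝ) ∞ g.weylNormSq := by
  have h : g.weylNormSq = fun x ↦ g.curvNormSqWith g.leviCivita x - 2 * g.normSq x (g.ricci x) +
      g.scalarCurvature x ^ 2 / 3 := funext fun x ↦ g.weylNormSq_eq_curvNormSqWith hg hE x
  rw [h]
  exact (g.contMDiff_curvNormSqWith.sub (contMDiff_const.mul g.contMDiff_normSq_ricci')).add
    ((g.contMDiff_scalarCurvature.pow 2).div_const _)

omit [I.Boundaryless] in
/-- **`σ₂(A_g)` is `C^∞`** (`−½|E|² + R²/24`, `sigma2WeylSchouten_eq`), for a Riemannian `C^∞`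
metric on a `4`-dimensional model — Chang–Gursky–Yang 2003, p. 111: "at each point of `M⁴`,
`g⁻¹A` has `4` real eigenvalues, thus `σ_k(g⁻¹A)` is a smooth function on `M⁴`".
[cite: ChangGurskyYang2003, §1, p. 111] -/
theorem _root_.Literature.Geometry.Lorentzian.PseudoRiemannianMetric.contMDiff_sigma2WeylSchouten
    (hg : g.IsRiemannian) (hE : finrank ℝ E = 4) : ContMDiff I 𝓘(ℝ) ∞ g.sigma2WeylSchouten := by
  have h : g.sigma2WeylSchouten = fun x ↦
      -(1 / 2) * g.tracelessRicciNormSq x + g.scalarCurvature x ^ 2 / 24 :=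
    funext fun x ↦ g.sigma2WeylSchouten_eq (WithTop.coe_le_coe.mpr le_top) hE (fun v hv ↦ hg x v hv)
  rw [h]
  exact (contMDiff_const.mul (g.contMDiff_tracelessRicciNormSq hg hE)).add
    ((g.contMDiff_scalarCurvature.pow 2).div_const _)

/-- **The `Q`-curvature is `C^∞`**: `Q = (1/12)(−Δ_g R + ¼R² − 3|E|²)` (Chang–Gursky–Yang 2003,
p. 113) with `Δ_g R` smooth (`contMDiff_dalembertian`, the Laplacian of the smooth function `R`),
for a Riemannian `C^∞` metric on a boundaryless `4`-dimensional model — the smooth upgrade of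
`continuous_qCurvature`. [cite: ChangGurskyYang2003, §1, (1.11), p. 113] -/
theorem _root_.Literature.Geometry.Lorentzian.PseudoRiemannianMetric.contMDiff_qCurvature
    (hg : g.IsRiemannian) (hE : finrank ℝ E = 4) : ContMDiff I 𝓘(ℝ) ∞ g.qCurvature := by
  have h : g.qCurvature = fun x ↦ 1 / 12 * (-(g.dalembertian g.scalarCurvature x) +
      1 / 4 * g.scalarCurvature x ^ 2 - 3 * g.tracelessRicciNormSq x) :=
    funext fun x ↦ g.qCurvature_def x
  rw [h]
  exact contMDiff_const.mul (((contMDiff_dalembertian g g.contMDiff_scalarCurvature).neg.add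
    (contMDiff_const.mul (g.contMDiff_scalarCurvature.pow 2))).sub
    (contMDiff_const.mul (g.contMDiff_tracelessRicciNormSq hg hE)))

end Smoothness

/-! ### The Weyl-weighted Gursky–Viaclovsky path operator is smooth -/

section Path

variable {M : Type*} [TopologicalSpace M] [ChartedSpace (EuclideanSpace ℝ (Fin 4)) M]
  [IsManifold (𝓡 4) ∞ M]
  (h : PseudoRiemannianMetric (𝓡 4) ∞ (EuclideanSpace ℝ (Fin 4)) (TangentSpace (𝓡 4) : M → Type _))
  [h.HasLeviCivita]

/-- **`P_t(h) = σ₂(A_h) − ¼|W_h|² + (1−t)(2−t)R_h²/6` is `C^∞`** for a Riemannian `C^∞` metric `h` on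
a `4`-manifold and every `t` (`GurskyViaclovskyPath.pathOperator`; Gursky–Viaclovsky 2003, §3: the
right-hand side `f` of the path at its start is this function at `t = δ`, and "since `f ∈ C^∞(M)` …
`u_t ∈ C^∞(M)`", §5). [cite: GurskyViaclovsky2003, §3 and §5] [cite: ChangGurskyYang2003, (1.10)] -/
theorem GurskyViaclovskyPath.contMDiff_pathOperator (hh : h.IsRiemannian) (t : ℝ) :
    ContMDiff (𝓡 4) 𝓘(ℝ) ∞ fun x ↦ GurskyViaclovskyPath.pathOperator h t x := by
  have hE : finrank ℝ (EuclideanSpace ℝ (Fin 4)) = 4 := finrank_euclideanSpace_fin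
  unfold GurskyViaclovskyPath.pathOperator
  exact ((h.contMDiff_sigma2WeylSchouten hh hE).sub
    (contMDiff_const.mul (h.contMDiff_weylNormSq hh hE))).add
    ((contMDiff_const.mul (h.contMDiff_scalarCurvature.pow 2)).div_const _)

/-- **The Gursky–Viaclovsky path starts** (Gursky–Viaclovsky 2003, §3, first paragraph: "Since
`R_g > 0`, there exists `δ > −∞` so that `A^δ_g` is positive definite … Note that `u ≡ 0` is a
solution of (path) for `t = δ`"; here with the Weyl weight of Chang–Gursky–Yang 2003, (1.10)): on a
compact `4`-manifold, for a `C^∞` Riemannian metric `h` of positive scalar curvature there is a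
parameter `δ ≤ 1` at which `P_δ(h) = σ₂(A_h) − ¼|W_h|² + (1−δ)(2−δ)R_h²/6` is (smooth and) POSITIVE
everywhere. Proof: `P_δ = P_1 + (1−δ)(2−δ)R²/6` (`pathOperator_eq_pathOperator_one_add`); by
compactness `P_1 ≥ C` and `R ≥ m > 0`, and with `1 − δ = K := 6|C|/m² + 1` one has
`(1−δ)(2−δ)R²/6 ≥ K m²/6 = |C| + m²/6`, so `P_δ ≥ C + |C| + m²/6 > 0`.
[cite: GurskyViaclovsky2003, §3] [cite: ChangGurskyYang2003, (1.10)] -/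
theorem GurskyViaclovskyPath.exists_pathOperator_pos [CompactSpace M] (hh : h.IsRiemannian)
    (hR : ∀ x, 0 < h.scalarCurvature x) :
    ∃ δ : ℝ, δ ≤ 1 ∧ ContMDiff (𝓡 4) 𝓘(ℝ) ∞ (fun x ↦ GurskyViaclovskyPath.pathOperator h δ x) ∧
      ∀ x, 0 < GurskyViaclovskyPath.pathOperator h δ x := by
  rcases isEmpty_or_nonempty M with hM | hM
  · exact ⟨1, le_rfl, GurskyViaclovskyPath.contMDiff_pathOperator h hh 1, fun x ↦ (hM.false x).elim⟩
  -- lower bounds `P_1 ≥ C` and `R ≥ m > 0` on the compact manifold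
  have hP1c : Continuous fun x ↦ GurskyViaclovskyPath.pathOperator h 1 x :=
    (GurskyViaclovskyPath.contMDiff_pathOperator h hh 1).continuous
  have hRc : Continuous h.scalarCurvature := h.contMDiff_scalarCurvature.continuous
  obtain ⟨x₀, -, hx₀⟩ := isCompact_univ.exists_isMinOn univ_nonempty hP1c.continuousOn
  obtain ⟨x₁, -, hx₁⟩ := isCompact_univ.exists_isMinOn univ_nonempty hRc.continuousOn
  set C : ℝ := GurskyViaclovskyPath.pathOperator h 1 x₀ with hC
  set m : ℝ := h.scalarCurvature x₁ with hm
  have hm0 : 0 < m := hR x₁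
  have hCle : ∀ x, C ≤ GurskyViaclovskyPath.pathOperator h 1 x := fun x ↦ hx₀ (mem_univ x)
  have hmle : ∀ x, m ≤ h.scalarCurvature x := fun x ↦ hx₁ (mem_univ x)
  -- the parameter
  set K : ℝ := 6 * |C| / m ^ 2 + 1 with hK
  have hK0 : 0 ≤ K := by positivity
  refine ⟨1 - K, by linarith, GurskyViaclovskyPath.contMDiff_pathOperator h hh _, fun x ↦ ?_⟩
  rw [GurskyViaclovskyPath.pathOperator_eq_pathOperator_one_add]
  have h1 : (1 - (1 - K)) * (2 - (1 - K)) = K * (K + 1) := by ring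
  rw [h1]
  have hR2 : m ^ 2 ≤ h.scalarCurvature x ^ 2 := pow_le_pow_left₀ hm0.le (hmle x) 2
  have hKK : K ≤ K * (K + 1) := by nlinarith
  have hKm : K * m ^ 2 / 6 = |C| + m ^ 2 / 6 := by
    rw [hK]
    field_simp
  have h2 : |C| + m ^ 2 / 6 ≤ K * (K + 1) * h.scalarCurvature x ^ 2 / 6 := by
    rw [← hKm]
    have : K * m ^ 2 ≤ K * (K + 1) * h.scalarCurvature x ^ 2 :=
      mul_le_mul hKK hR2 (sq_nonneg _) (mul_nonneg hK0 (by linarith))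
    linarith
  have h3 := hCle x
  have h4 : -C ≤ |C| := neg_le_abs C
  nlinarith [sq_nonneg m]

end Path

end Literature.Geometry.Riemannian

end
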